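import Literature.Geometry.Kaehler.ComplexTorusPuncturedDiscCovering
import Literature.Geometry.Kaehler.RiemannSurfaceGenusOneClassification
import HarnessLib

/-!
# The disc covers every compact genus-one Riemann surface minus a non-empty finite set

Topic `Literature/Geometry/Kaehler` (PROOF-ONLY; abc-iut cell, programme «UNIF-G1P», GAP G-L4t8g7-1,
spine item S1).  Classical uniformization (Farkas–Kra, *Riemann Surfaces*, IV.6.3–IV.6.4: the Riemann
surfaces not covered by the disc are the sphere, the plane, the punctured plane and the compact tori;
hence a compact surface of genus one with `r ≥ 1` punctures — a hyperbolic curve of type `(1, r)`, e.g.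
the curves `X̲_v` of type `(1, ℓ)` of inter-universal Teichmüller theory — is uniformized by the disc).
We combine the tree's genus-one uniformization
(`RiemannSurface.MeromorphicOneForm.exists_biholomorphic_complexTorus_of_homeomorph_torus`: a compact
connected Riemann surface homeomorphic to `ℝ/ℤ × ℝ/ℤ` is biholomorphic to a complex torus `ℂ/Φ(ℤ²)`)
with the disc covering of the punctured model torus (`ComplexTorus.exists_disc_covering_compl_finite`),
CONDITIONAL on the named fact `Complex.PlaneDomainDiscCovering` (uniformization of plane domains),
which is taken as a hypothesis.

* `RiemannSurface.exists_disc_covering_compl_finite_of_homeomorph_torus` — `T` compact connected,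
  `T ≃ₜ ℝ/ℤ × ℝ/ℤ`, `S ⊆ T` finite non-empty ⇒ a surjective holomorphic covering map `𝔻 → T ∖ S`;
* `RiemannSurface.exists_disc_covering_of_biholomorphic_torus_minus_finite` — the same for any Riemann
  surface `X` biholomorphic to such a `T ∖ S` (the shape of a typed "curve of type `(1, r)`").

## References
* [FarkasKra1992] IV.6.3–IV.6.4 (uniformization of the non-exceptional surfaces by the disc).
-/

noncomputable section

open Set Function Metric TopologicalSpace
open scoped Manifold ContDiff Topology

namespace Literature.Geometry.Kaehler

namespace RiemannSurface

/-- A map between open subsets whose composite with the inclusions is, at every point of the source,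
a differentiable map of the ambient manifolds is holomorphic. [folklore] -/
private theorem mdifferentiable_opens_of_val_eq_at' {M : Type} [TopologicalSpace M] [ChartedSpace ℂ M]
    {M' : Type} [TopologicalSpace M'] [ChartedSpace ℂ M'] {U : Opens M} {V : Opens M'} {g : M → M'}
    (e : U → V) (he : ∀ x : U, (e x : M') = g x)
    (hg : ∀ x : U, MDifferentiableAt 𝓘(ℂ, ℂ) 𝓘(ℂ, ℂ) g x) : MDifferentiable 𝓘(ℂ, ℂ) 𝓘(ℂ, ℂ) e := by
  intro x
  have h1 : MDifferentiableAt 𝓘(ℂ, ℂ) 𝓘(ℂ, ℂ) (Subtype.val ∘ e) x ↔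
      MDifferentiableAt 𝓘(ℂ, ℂ) 𝓘(ℂ, ℂ) e x :=
    ChartedSpace.liftPropWithinAt_subtypeVal_comp_iff ..
  rw [← h1]
  have : (Subtype.val ∘ e) = fun x : U => g x := funext fun x => he x
  rw [this]
  exact (((differentiableWithinAt_localInvariantProp (I := 𝓘(ℂ, ℂ))
    (I' := 𝓘(ℂ, ℂ))).liftPropAt_iff_comp_subtype_val _ _).symm).2 (hg x)

variable (T : Type) [TopologicalSpace T] [T2Space T] [CompactSpace T] [ConnectedSpace T]
  [ChartedSpace ℂ T] [IsManifold 𝓘(ℂ, ℂ) ω T]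

/-- **The disc is the holomorphic universal covering of a compact genus-one Riemann surface minus a
non-empty finite set** (Farkas–Kra IV.6: hyperbolic curves of type `(1, r)`, `r ≥ 1`), conditional on
`Complex.PlaneDomainDiscCovering`: for `T` a compact connected Riemann surface homeomorphic to
`ℝ/ℤ × ℝ/ℤ` and `S ⊆ T` finite and non-empty there is a surjective holomorphic covering map from the
open unit disc onto the Riemann surface `T ∖ S`.  Route: `T ≅ ℂ/Φ(ℤ²)` biholomorphically (genus-one
uniformization), then `ComplexTorus.exists_disc_covering_compl_finite`.
[cite: FarkasKra1992, IV.6.4] -/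
theorem exists_disc_covering_compl_finite_of_homeomorph_torus (H : Complex.PlaneDomainDiscCovering)
    (e₀ : T ≃ₜ AddCircle (1 : ℝ) × AddCircle (1 : ℝ)) {S : Set T} (hS : S.Finite) (hne : S.Nonempty) :
    ∃ p : (⟨ball (0 : ℂ) 1, isOpen_ball⟩ : Opens ℂ) → (⟨Sᶜ, hS.isClosed.isOpen_compl⟩ : Opens T),
      IsCoveringMap p ∧ Function.Surjective p ∧ MDifferentiable 𝓘(ℂ, ℂ) 𝓘(ℂ, ℂ) p := by
  obtain ⟨Φ, e, -, hesymm⟩ :=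
    MeromorphicOneForm.exists_biholomorphic_complexTorus_of_homeomorph_torus (T := T) e₀
  -- the image puncture set in the model torus
  have hS' : (e '' S).Finite := hS.image e
  have hne' : (e '' S).Nonempty := hne.image e
  obtain ⟨p₀, hp₀, hsurj₀, hp₀d⟩ := ComplexTorus.exists_disc_covering_compl_finite Φ H hS' hne'
  -- `e⁻¹` restricted to the complements
  let X : Opens T := ⟨Sᶜ, hS.isClosed.isOpen_compl⟩
  let X' : Opens (ComplexTorus Φ) := ⟨(e '' S)ᶜ, hS'.isClosed.isOpen_compl⟩
  have hiff : ∀ y : ComplexTorus Φ, y ∈ X' ↔ e.symm y ∈ X := by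
    intro y
    change y ∉ e '' S ↔ e.symm y ∉ S
    rw [e.image_eq_preimage_symm, Set.mem_preimage]
  let ε : X' ≃ₜ X := e.symm.subtype hiff
  have hε : MDifferentiable 𝓘(ℂ, ℂ) 𝓘(ℂ, ℂ) (ε : X' → X) :=
    mdifferentiable_opens_of_val_eq_at' (g := e.symm) _ (fun _ => rfl) fun x => hesymm (x : ComplexTorus Φ)
  exact ⟨ε ∘ p₀, hp₀.homeomorph_comp ε, ε.surjective.comp hsurj₀, hε.comp hp₀d⟩

variable {T} in
/-- **Every Riemann surface biholomorphic to a compact genus-one surface minus a non-empty finite set is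
holomorphically covered by the disc** (the typed shape of "a hyperbolic curve of type `(1, r)`,
`r ≥ 1`"), conditional on `Complex.PlaneDomainDiscCovering`. [cite: FarkasKra1992, IV.6.4] -/
theorem exists_disc_covering_of_biholomorphic_torus_minus_finite (H : Complex.PlaneDomainDiscCovering)
    (e₀ : T ≃ₜ AddCircle (1 : ℝ) × AddCircle (1 : ℝ)) {S : Set T} (hS : S.Finite) (hne : S.Nonempty)
    {X : Type} [TopologicalSpace X] [ChartedSpace ℂ X]
    (φ : X ≃ₜ (⟨Sᶜ, hS.isClosed.isOpen_compl⟩ : Opens T))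
    (hφ : MDifferentiable 𝓘(ℂ, ℂ) 𝓘(ℂ, ℂ) φ.symm) :
    ∃ p : (⟨ball (0 : ℂ) 1, isOpen_ball⟩ : Opens ℂ) → X,
      IsCoveringMap p ∧ Function.Surjective p ∧ MDifferentiable 𝓘(ℂ, ℂ) 𝓘(ℂ, ℂ) p := by
  obtain ⟨p, hp, hsurj, hpd⟩ := exists_disc_covering_compl_finite_of_homeomorph_torus T H e₀ hS hne
  exact ⟨φ.symm ∘ p, hp.homeomorph_comp φ.symm, φ.symm.surjective.comp hsurj, hφ.comp hpd⟩

end RiemannSurface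

end Literature.Geometry.Kaehler

end
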